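import Literature.IUT.LogVolume.Corollary22PartISigma
import Literature.IUT.LogVolume.Corollary22PartIAll
import Literature.NumberTheory.DiophantineGeometry.GenEllJInvReductionProofs
import HarnessLib

/-!
# [IUTchIV] Corollary 2.2 (i), first equivalence `(1/6)·log(q^{∤S}) ≈ (1/6)·log(q^∀)` ON POINTS OF
# BOUNDED DEGREE — with no hypothesis on the `j`-invariant (print, proof of Cor. 2.3, p. 55)

Mochizuki, *Inter-universal Teichmüller theory IV*, RIMS manuscript (Apr. 2020) = PRIMS **57** (2021),
Cor. 2.2 (i), p. 41, proof p. 44 ("in light of the condition (∗^{j-inv}) … `log(q^{∤2}) ≈ log(q^∀)`"), and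
proof of Cor. 2.3, p. 55: "[Here, we note, with regard to the condition “(∗^{j-inv})” of Corollary 2.2, that
this condition only concerns the behavior of `K_V ∩ U_X(ℚ̄)^{≤d}` as `d` varies; that is to say, this
condition is entirely vacuous in situations, i.e., such as the situation considered in [GenEll], Theorem 2.1,
(ii), in which one is only concerned with `K_V ∩ U_X(ℚ̄)^{≤d}` for a fixed `d`.]"
[claim: Mochizuki2012, status: disputed — the statements of THIS file are classical valuation theory
(local heights at places over finitely many primes, Krasner's finiteness) and are PROVED unconditionally].

PROOF-ONLY sequel of `Corollary22PartISigma.lean` (abc-iut-w4-d101), which proves the `S`-exempt first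
equivalence `Cor22.partI_avoiding` on ALL of `K_V` under the `S`-analogue of (∗^{j-inv}) — for every
`p ∈ S`, `|j|` bounded on the bounding domain `K_p`. THIS file proves print's p. 55 remark for that
equivalence: on the points of `K_V` of degree `≤ d` NO hypothesis on `j` is needed, for any finite set `S`
of primes in the support:

* `Cor22.partI_first_avoiding_of_degree_le` — `S ⊆ Supp(K_V)` ⟹ for every `d`,
  `(1/6)·log(q^{∤S}) ≈ (1/6)·log(q^∀)` on `K_V ∩ {[F:ℚ] ≤ d}`; `Cor22.partI_first_avoiding_UPle` — the same
  on `K_V ∩ U_X(ℚ̄)^{≤d}` (the tree's `UPle d`), the shape in which [GenEll] Thm. 2.1 (ii) and the proof of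
  Cor. 2.3 consume Cor. 2.2; `Cor22.partI_first_UPle` — `S = {2}`: print's own first equivalence on
  `K_V ∩ U_X(ℚ̄)^{≤d}` from `2 ∈ Supp(K_V)` ALONE; hence `Cor22.partI_UPle_of_supportContains` — ALL of
  Cor. 2.2 (i) on `K_V ∩ U_X(ℚ̄)^{≤d}` without (∗^{j-inv}) (with `Cor22.partI_middle`/`partI_third`).

THE ARGUMENT. The conjugates `σ(λ) ∈ K_p` (`σ : F → ℚ̄_p`) of a point of degree `≤ d` have degree `≤ d`
over `ℚ_p` (`ringHom_apply_mem_degLeSet`); the points of `ℚ̄_p` of degree `≤ d` lie in finitely many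
subfields `K` (Krasner's finiteness — PROVED in the tree, `krasner_finite_subextensions_holds`,
`GenEllJInvReductionProofs.lean`), each `K_p ∩ X(K)` is compact (`CBData.Knon_compactDomain`) and `j` is
continuous on `U ⊇ K_p`, so `|j| ≤ M_p` on `K_p ∩ {deg ≤ d}` (`exists_bound_jInv_knon_degLeSet`). Then
print's p. 44 argument runs prime by prime exactly as in `Corollary22PartISigma.lean`, but over an
ARBITRARY set of presented points `𝓕` on which, for each `p ∈ S`, `‖j(σ(λ))‖ ≤ C_p` (the `…_of_bounds`
lemmas below; the `K_V`-versions of `Corollary22PartISigma.lean` are their instances `𝓕 = K_V`):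
`‖σ(p^a·j(λ))‖ ≤ 1` at all `σ` ⟹ `p^a·j(λ)` integral at all `v ∣ p`
(`Cor22.valuation_le_one_of_forall_norm_embedding_le_one`) ⟹ `h_v ≤ a·e_v`
(`Cor22.localHeight_le_of_valuation_prime_pow_mul_le_one`) ⟹ the `p`-part of `log(q^∀)` is `≤ a·log p`
(fundamental identity `sum_localDegree`) ⟹ `log(q^∀) ≤ log(q^{∤S}) + Σ_{p∈S} a_p·log p` on `𝓕`.

No new definitions; `Corollary22PartISigma.lean` / `GenEllJInvReduction*.lean` are imported, not edited.
No side is taken on [IUTchIII] Cor. 3.12; nothing here concerns it or Cor. 2.2 (ii)/(iii).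
-/

noncomputable section

namespace Literature.IUT.LogVolume

namespace Cor22

open NumberField IsDedekindDomain
open Literature.NumberTheory.DiophantineGeometry.GenEll

/-! ## Print's p. 44 argument over an arbitrary set of points with `p`-adic bounds on `|j|` -/

/-- **(∗^{j-inv}) at `p` on a point set, made effective.** If `‖j(σ(λ))‖ ≤ C` for every point `P = (F, λ)`
of a set `𝓕` and every `σ : F → ℚ̄_p`, then `‖σ(p^a·j(λ))‖ ≤ 1` for some `a ∈ ℕ` and all such `P, σ`
(`C ≤ p^a`, `Cor22.exists_le_prime_pow`); `𝓕 = K_V`: `Cor22.exists_norm_embedding_prime_pow_mul_jInv_le_one`.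
[cite: Mochizuki2012, Cor 2.2 (i) p.41] -/
theorem exists_norm_embedding_prime_pow_mul_jInv_le_one_of_bounds (p : ℕ) [Fact p.Prime]
    {𝓕 : Set NFPoint} {C : ℝ} (hC : ∀ P ∈ 𝓕, ∀ σ : P.F →+* PadicAlgCl p, ‖jInv (σ P.x)‖ ≤ C) :
    ∃ a : ℕ, ∀ P ∈ 𝓕, ∀ σ : P.F →+* PadicAlgCl p, ‖σ ((p : P.F) ^ a * jInv P.x)‖ ≤ 1 := by
  obtain ⟨a, ha⟩ := exists_le_prime_pow p C
  refine ⟨a, fun P hP σ => ?_⟩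
  have hj : ‖σ (jInv P.x)‖ ≤ C := by rw [ringHom_map_jInv]; exact hC P hP σ
  have hp0 : (0 : ℝ) < (p : ℝ) ^ a := by
    have : (0 : ℝ) < p := by exact_mod_cast (Fact.out : p.Prime).pos
    positivity
  rw [map_mul, map_pow, map_natCast, norm_mul, norm_pow, norm_natCast_prime_padicAlgCl, inv_pow,
    inv_mul_le_iff₀ hp0, mul_one]
  exact hj.trans ha

open scoped Classical in
/-- **The `p`-adic part of `log(q^∀)` is bounded on such a point set**: `Σ_{v ∣ p, bad} h_v·log N(v) ≤
a·[F:ℚ]·log p` for some `a ∈ ℕ` and all `P = (F, λ) ∈ 𝓕` (`p^a·j(λ)` is integral at all `v ∣ p` by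
`Cor22.valuation_le_one_of_forall_norm_embedding_le_one`, so `h_v ≤ a·e_v` by
`Cor22.localHeight_le_of_valuation_prime_pow_mul_le_one`; sum against `log N(v) = f_v·log p`, `Σ e_v f_v =
[F:ℚ]`); `𝓕 = K_V`: `Cor22.exists_sum_localHeight_prime_le`. [cite: Mochizuki2012, Cor 2.2 (i) p.41] -/
theorem exists_sum_localHeight_prime_le_of_bounds (p : ℕ) [Fact p.Prime] {𝓕 : Set NFPoint}
    {C : ℝ} (hC : ∀ P ∈ 𝓕, ∀ σ : P.F →+* PadicAlgCl p, ‖jInv (σ P.x)‖ ≤ C) :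
    ∃ a : ℕ, ∀ P ∈ 𝓕,
      ∑ v ∈ (badPlaces P).filter (fun v => (p : 𝓞 P.F) ∈ v.asIdeal),
        localHeight P v * logNorm P.F v ≤ a * (Module.finrank ℚ P.F * Real.log p) := by
  have hp : p ≠ 0 := (Fact.out : p.Prime).ne_zero
  obtain ⟨a, ha⟩ := exists_norm_embedding_prime_pow_mul_jInv_le_one_of_bounds p hC
  refine ⟨a, fun P hP => ?_⟩
  have hval : ∀ v : HeightOneSpectrum (𝓞 P.F), (p : 𝓞 P.F) ∈ v.asIdeal →
      v.valuation P.F ((p : P.F) ^ a * jInv P.x) ≤ 1 :=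
    fun v hv => valuation_le_one_of_forall_norm_embedding_le_one p (ha P hP) v hv
  have hterm : ∀ v ∈ (badPlaces P).filter (fun v => (p : 𝓞 P.F) ∈ v.asIdeal),
      localHeight P v * logNorm P.F v ≤ a * Real.log p * localDegree P.F v := by
    intro v hv
    rw [Finset.mem_filter] at hv
    have hvp : v ∈ placesOver P.F p := mem_placesOver_of_natCast_mem p v hv.2
    have hres : residueChar P.F v = p := (mem_placesOver_iff_residueChar v).mp hvp
    have hord : (ord P.F v (p : P.F) : ℝ) = ramIdx P.F v := by
      exact_mod_cast ord_natCast_eq_ramIdx p v hvp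
    have hlh : localHeight P v ≤ a * (ramIdx P.F v : ℝ) := by
      rw [← hord]
      exact localHeight_le_of_valuation_prime_pow_mul_le_one P v p hp a (hval v hv.2)
    have hln : logNorm P.F v = resDeg P.F v * Real.log p := by rw [logNorm_eq, hres]
    rw [hln, localDegree, Nat.cast_mul]
    have hf : (0 : ℝ) ≤ resDeg P.F v * Real.log p := by
      have : (0 : ℝ) ≤ Real.log p := Real.log_natCast_nonneg p
      positivity
    calc localHeight P v * (resDeg P.F v * Real.log p)
        ≤ a * (ramIdx P.F v : ℝ) * (resDeg P.F v * Real.log p) := mul_le_mul_of_nonneg_right hlh hf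
      _ = a * Real.log p * (ramIdx P.F v * resDeg P.F v : ℝ) := by ring
  have hsub : (badPlaces P).filter (fun v => (p : 𝓞 P.F) ∈ v.asIdeal) ⊆ placesOver P.F p :=
    fun v hv => mem_placesOver_of_natCast_mem p v (Finset.mem_filter.mp hv).2
  have hlog : (0 : ℝ) ≤ Real.log p := Real.log_natCast_nonneg p
  calc ∑ v ∈ (badPlaces P).filter (fun v => (p : 𝓞 P.F) ∈ v.asIdeal), localHeight P v * logNorm P.F v
      ≤ ∑ v ∈ (badPlaces P).filter (fun v => (p : 𝓞 P.F) ∈ v.asIdeal),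
          a * Real.log p * (localDegree P.F v : ℝ) := Finset.sum_le_sum hterm
    _ ≤ ∑ v ∈ placesOver P.F p, a * Real.log p * (localDegree P.F v : ℝ) :=
        Finset.sum_le_sum_of_subset_of_nonneg hsub fun v _ _ => by positivity
    _ = a * Real.log p * ∑ v ∈ placesOver P.F p, (localDegree P.F v : ℝ) := by rw [Finset.mul_sum]
    _ = a * (Module.finrank ℚ P.F * Real.log p) := by rw [← Nat.cast_sum, sum_localDegree]; ring

/-- `Σ_{x ∈ ⋃_{i ∈ s} t(i)} g(x) ≤ Σ_{i ∈ s} Σ_{x ∈ t(i)} g(x)` for `g ≥ 0` (a union bound). [folklore] -/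
private theorem sum_biUnion_le_sum' {ι κ : Type*} [DecidableEq κ] (s : Finset ι) (t : ι → Finset κ)
    (g : κ → ℝ) (hg : ∀ x, 0 ≤ g x) : ∑ x ∈ s.biUnion t, g x ≤ ∑ i ∈ s, ∑ x ∈ t i, g x := by
  classical
  induction s using Finset.induction_on with
  | empty => simp
  | insert a s ha ih =>
    rw [Finset.biUnion_insert, Finset.sum_insert ha]
    have hu : ∑ x ∈ t a ∪ s.biUnion t, g x ≤ ∑ x ∈ t a, g x + ∑ x ∈ s.biUnion t, g x := by
      rw [← Finset.sum_union_inter]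
      have : 0 ≤ ∑ x ∈ t a ∩ s.biUnion t, g x := Finset.sum_nonneg fun x _ => hg x
      linarith
    linarith

open scoped Classical in
/-- The `S`-part of `Σ_{v bad} h_v·log N(v)` is at most the sum over `p ∈ S` of the `p`-parts (a bad place
over some `p ∈ S` is counted at least once on the right, `Cor22.filter_exists_mem_subset_biUnion`; all terms
are `≥ 0`). [cite: Mochizuki2012, Cor 2.2 (i) p.41] -/
theorem sum_localHeight_filter_not_forall_le (P : NFPoint) (S : Finset ℕ) :
    ∑ v ∈ (badPlaces P).filter (fun v => ¬ ∀ p ∈ S, ((p : ℕ) : 𝓞 P.F) ∉ v.asIdeal),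
        localHeight P v * logNorm P.F v ≤
      ∑ p ∈ S, ∑ v ∈ (badPlaces P).filter (fun v => ((p : ℕ) : 𝓞 P.F) ∈ v.asIdeal),
        localHeight P v * logNorm P.F v := by
  have hg : ∀ v : HeightOneSpectrum (𝓞 P.F), 0 ≤ localHeight P v * logNorm P.F v :=
    fun v => mul_nonneg (localHeight_nonneg P v) (logNorm_pos P.F v).le
  exact (Finset.sum_le_sum_of_subset_of_nonneg (filter_exists_mem_subset_biUnion P S)
    fun v _ _ => hg v).trans (sum_biUnion_le_sum' S _ _ hg)

open scoped Classical in
/-- **`log(q^∀) ≤ log(q^{∤S}) + B` on `𝓕`** for a finite set `S` of primes such that, for each `p ∈ S`,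
`‖j(σ(λ))‖` is bounded over `P = (F, λ) ∈ 𝓕`, `σ : F → ℚ̄_p`: the difference is the normalised degree of
the `S`-part of the `q`-parameter divisor (`Cor22.qDivisor_empty_eq_add`), bounded prime by prime
(`B = Σ_{p∈S} a_p·log p`); `𝓕 = K_V`: `Cor22.exists_logQForall_le_logQAvoid_add`. [cite: Mochizuki2012, Cor 2.2 (i) p.41] -/
theorem exists_logQForall_le_logQAvoid_add_of_bounds {𝓕 : Set NFPoint} (S : Finset ℕ)
    (hS : ∀ p ∈ S, p.Prime)
    (hj : ∀ p ∈ S, ∀ [Fact p.Prime], ∃ C : ℝ, ∀ P ∈ 𝓕, ∀ σ : P.F →+* PadicAlgCl p, ‖jInv (σ P.x)‖ ≤ C) :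
    ∃ B : ℝ, ∀ P ∈ 𝓕, logQForall P ≤ logQAvoid P S + B := by
  have hb : ∀ p ∈ S, ∃ a : ℕ, ∀ P ∈ 𝓕,
      ∑ v ∈ (badPlaces P).filter (fun v => ((p : ℕ) : 𝓞 P.F) ∈ v.asIdeal),
        localHeight P v * logNorm P.F v ≤ a * (Module.finrank ℚ P.F * Real.log p) := by
    intro p hp
    haveI : Fact p.Prime := ⟨hS p hp⟩
    obtain ⟨C, hC⟩ := hj p hp
    exact exists_sum_localHeight_prime_le_of_bounds p hC
  choose! a ha using hb
  refine ⟨∑ p ∈ S, a p * Real.log p, fun P hP => ?_⟩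
  have hn : (0 : ℝ) < Module.finrank ℚ P.F := FinDivisor.finrank_pos
  unfold logQForall logQAvoid
  rw [qDivisor_empty_eq_add P S, map_add, add_le_add_iff_left, FinDivisor.ndeg_apply,
    FinDivisor.deg_sum_of, div_le_iff₀ hn]
  calc ∑ v ∈ (badPlaces P).filter (fun v => ¬ ∀ p ∈ S, ((p : ℕ) : 𝓞 P.F) ∉ v.asIdeal),
          localHeight P v * logNorm P.F v
      ≤ ∑ p ∈ S, ∑ v ∈ (badPlaces P).filter (fun v => ((p : ℕ) : 𝓞 P.F) ∈ v.asIdeal),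
          localHeight P v * logNorm P.F v := sum_localHeight_filter_not_forall_le P S
    _ ≤ ∑ p ∈ S, (a p : ℝ) * (Module.finrank ℚ P.F * Real.log p) :=
        Finset.sum_le_sum fun p hp => ha p hp P hP
    _ = (∑ p ∈ S, (a p : ℝ) * Real.log p) * Module.finrank ℚ P.F := by
        rw [Finset.sum_mul]
        exact Finset.sum_congr rfl fun p _ => by ring

/-- **`(1/6)·log(q^{∤S}) ≈ (1/6)·log(q^∀)` on `𝓕`** under the same `p`-adic bounds on `|j|` (`p ∈ S`): the
lower bound `log(q^{∤S}) ≤ log(q^∀)` is `Cor22.logQAvoid_anti`, the upper bound is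
`exists_logQForall_le_logQAvoid_add_of_bounds`. [cite: Mochizuki2012, Cor 2.2 (i) p.41] -/
theorem bdEquiv_logQAvoid_logQForall_of_bounds {𝓕 : Set NFPoint} (S : Finset ℕ)
    (hS : ∀ p ∈ S, p.Prime)
    (hj : ∀ p ∈ S, ∀ [Fact p.Prime], ∃ C : ℝ, ∀ P ∈ 𝓕, ∀ σ : P.F →+* PadicAlgCl p, ‖jInv (σ P.x)‖ ≤ C) :
    BDEquiv 𝓕 (fun P => 1 / 6 * logQAvoid P S) (fun P => 1 / 6 * logQForall P) := by
  obtain ⟨B, hB⟩ := exists_logQForall_le_logQAvoid_add_of_bounds S hS hj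
  refine ⟨B / 6, fun P hP => ?_⟩
  have h1 : logQAvoid P S ≤ logQForall P := logQAvoid_anti P (Finset.empty_subset _)
  have h2 := hB P hP
  rw [abs_le]
  constructor <;> linarith

/-! ## `|j|` is bounded on `K_p ∩ {deg ≤ d}` (Krasner's finiteness, proved in the tree) -/

/-- `j` is continuous away from `λ = 0, 1`. [folklore] -/
private theorem continuousOn_jInv' {E : Type*} [NormedField E] :
    ContinuousOn (jInv : E → E) {y | y ≠ 0 ∧ y ≠ 1} := by
  have h : (jInv : E → E) = fun t => 2 ^ 8 * (t ^ 2 - t + 1) ^ 3 / (t ^ 2 * (t - 1) ^ 2) := rfl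
  rw [h]
  refine ContinuousOn.div (by fun_prop) (by fun_prop) fun y hy => ?_
  exact mul_ne_zero (pow_ne_zero _ hy.1) (pow_ne_zero _ (sub_ne_zero.mpr hy.2))

/-- `K_p ∩ X(K)` is compact in `ℚ̄_p` for a finite `K/ℚ_p` (image of the compact subset of `K` given by the
datum `CBData.Knon_compactDomain`). [cite: MochizukiGenEll2010, Ex 1.3 (ii) p.5] -/
private theorem isCompact_knon_inter' {p : ℕ} [Fact p.Prime] (D : CBData) (hp : p ∈ D.primes)
    (K : IntermediateField ℚ_[p] (PadicAlgCl p)) (hK : FiniteDimensional ℚ_[p] K) :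
    IsCompact (D.Knon p ∩ (K : Set (PadicAlgCl p))) := by
  have hc := (D.Knon_compactDomain p hp K hK).1
  have himg : D.Knon p ∩ (K : Set (PadicAlgCl p)) =
      Subtype.val '' {y : K | (y : PadicAlgCl p) ∈ D.Knon p} := by
    ext z
    constructor
    · rintro ⟨hz, hzK⟩
      exact ⟨⟨z, hzK⟩, hz, rfl⟩
    · rintro ⟨y, hy, rfl⟩
      exact ⟨hy, y.2⟩
  rw [himg]
  exact hc.image continuous_subtype_val

/-- **`|j|` is bounded on `K_p ∩ {deg ≤ d}`** for every prime `p` of the support and every `d`: the points of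
`ℚ̄_p` of degree `≤ d` over `ℚ_p` lie in finitely many subfields (Krasner's finiteness, PROVED in the tree as
`krasner_finite_subextensions_holds`), each `K_p ∩ X(K)` is compact and `j` is continuous on `U ⊇ K_p`
(unconditional public form of the step inside `vojtaIneq_of_forall_jInvBounded`).
[cite: BombieriGubler2006, proof of Prop 4.5.3] -/
theorem exists_bound_jInv_knon_degLeSet {p : ℕ} [Fact p.Prime] (D : CBData) (hp : p ∈ D.primes) (d : ℕ) :
    ∃ M : ℝ, ∀ y ∈ D.Knon p ∩ degLeSet p d, ‖jInv y‖ ≤ M := by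
  have hfin := krasner_finite_subextensions_holds p d
  have hcpt : IsCompact (D.Knon p ∩ degLeSet p d) := by
    rw [degLeSet, Set.inter_iUnion₂]
    exact hfin.isCompact_biUnion fun K hK' => isCompact_knon_inter' D hp K hK'.1
  have hsub : D.Knon p ∩ degLeSet p d ⊆ {y | y ≠ 0 ∧ y ≠ 1} :=
    fun y hy => D.Knon_subset p hp hy.1
  exact hcpt.exists_bound_of_continuousOn (continuousOn_jInv'.mono hsub)

/-- A conjugate `σ(x) ∈ ℚ̄_p` of a point `P = (F, x)` with `[F:ℚ] ≤ d` has degree `≤ d` over `ℚ_p`, i.e. lies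
in `degLeSet p d` (`deg_{ℚ_p} σ(x) ≤ deg_ℚ x ≤ [F:ℚ]`; no minimality of the presentation is needed).
[cite: BombieriGubler2006, proof of Prop 4.5.3] -/
theorem ringHom_apply_mem_degLeSet {p : ℕ} [Fact p.Prime] {d : ℕ} (P : NFPoint) (hP : P.degree ≤ d)
    (σ : P.F →+* PadicAlgCl p) : σ P.x ∈ degLeSet p d := by
  haveI : IsScalarTower ℚ ℚ_[p] (PadicAlgCl p) := IsScalarTower.of_algebraMap_eq (fun q => by simp)
  let τ : P.F →ₐ[ℚ] PadicAlgCl p := σ.toRatAlgHom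
  have hτ : τ P.x = σ P.x := rfl
  have hintQ : IsIntegral ℚ (σ P.x) := by
    rw [← hτ]; exact (Algebra.IsIntegral.isIntegral (R := ℚ) P.x).map τ
  have hint : IsIntegral ℚ_[p] (σ P.x) := hintQ.tower_top
  set K := IntermediateField.adjoin ℚ_[p] ({σ P.x} : Set (PadicAlgCl p)) with hKdef
  have hfd : FiniteDimensional ℚ_[p] K := IntermediateField.adjoin.finiteDimensional hint
  have hdeg : Module.finrank ℚ_[p] K ≤ d := by
    rw [hKdef, IntermediateField.adjoin.finrank hint]
    have h1 : minpoly ℚ_[p] (σ P.x) ∣ (minpoly ℚ (σ P.x)).map (algebraMap ℚ ℚ_[p]) :=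
      minpoly.dvd_map_of_isScalarTower ℚ ℚ_[p] (σ P.x)
    have hne : (minpoly ℚ (σ P.x)).map (algebraMap ℚ ℚ_[p]) ≠ 0 :=
      Polynomial.map_ne_zero (minpoly.ne_zero hintQ)
    have h2 := Polynomial.natDegree_le_of_dvd h1 hne
    rw [Polynomial.natDegree_map, ← hτ, minpoly.algHom_eq τ σ.injective P.x] at h2
    have h3 : (minpoly ℚ P.x).natDegree ≤ P.degree := minpoly.natDegree_le P.x
    exact h2.trans (h3.trans hP)
  exact Set.mem_iUnion₂.mpr ⟨K, ⟨hfd, hdeg⟩, IntermediateField.mem_adjoin_simple_self ℚ_[p] _⟩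

/-! ## Cor. 2.2 (i), first equivalence, on points of bounded degree — no hypothesis on `j` -/

/-- **[IUTchIV] Cor. 2.2 (i), first equivalence away from `S`, bounded degree**: if the support of `K_V`
contains the finite set of primes `S`, then for every `d`, `(1/6)·log(q^{∤S}) ≈ (1/6)·log(q^∀)` as
BD-classes on the points of `K_V` presented over fields of degree `≤ d` — with NO hypothesis on the
`j`-invariant (p. 55: "(∗^{j-inv}) … is entirely vacuous … for a fixed `d`"; here for `S` in place of `{2}`).
[cite: Mochizuki2012, Cor 2.2 (i) p.41] -/
theorem partI_first_avoiding_of_degree_le (D : CBData) {S : Finset ℕ} (hS : D.SupportContains S) (d : ℕ) :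
    BDEquiv (D.toSet ∩ {P | P.degree ≤ d})
      (fun P => 1 / 6 * logQAvoid P S) (fun P => 1 / 6 * logQForall P) := by
  refine bdEquiv_logQAvoid_logQForall_of_bounds S (fun p hp => D.primes_prime p (hS hp)) ?_
  intro p hp _
  obtain ⟨M, hM⟩ := exists_bound_jInv_knon_degLeSet D (hS hp) d
  exact ⟨M, fun P hP σ => hM _ ⟨hP.1.2 p (hS hp) σ, ringHom_apply_mem_degLeSet P hP.2 σ⟩⟩

/-- The same on `K_V ∩ U_X(ℚ̄)^{≤d}` (the tree's `UPle d`: points of `U_X` presented minimally over a field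
of degree `≤ d`), the shape in which [GenEll] Thm. 2.1 (ii) / the proof of Cor. 2.3 consume Cor. 2.2.
[cite: Mochizuki2012, Cor 2.2 (i) p.41] -/
theorem partI_first_avoiding_UPle (D : CBData) {S : Finset ℕ} (hS : D.SupportContains S) (d : ℕ) :
    BDEquiv (D.toSet ∩ UPle d)
      (fun P => 1 / 6 * logQAvoid P S) (fun P => 1 / 6 * logQForall P) := by
  obtain ⟨C, hC⟩ := partI_first_avoiding_of_degree_le D hS d
  exact ⟨C, fun P hP => hC P ⟨hP.1, hP.2.2⟩⟩

/-- The same in the display normalisation `log(q^{∤S})/6 ≈ log(q^∀)/6` of `Cor22.partI_avoiding`.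
[cite: Mochizuki2012, Cor 2.2 (i) p.41] -/
theorem partI_avoiding_UPle (D : CBData) {S : Finset ℕ} (hS : D.SupportContains S) (d : ℕ) :
    BDEquiv (D.toSet ∩ UPle d) (fun P => logQAvoid P S / 6) (fun P => logQForall P / 6) := by
  obtain ⟨C, hC⟩ := partI_first_avoiding_UPle D hS d
  refine ⟨C, fun P hP => ?_⟩
  have e : logQAvoid P S / 6 - logQForall P / 6 = 1 / 6 * logQAvoid P S - 1 / 6 * logQForall P := by
    ring
  show |logQAvoid P S / 6 - logQForall P / 6| ≤ C
  rw [e]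
  exact hC P hP

/-- In particular print's own first equivalence `(1/6)·log(q^{∤2}) ≈ (1/6)·log(q^∀)` holds on
`K_V ∩ U_X(ℚ̄)^{≤d}` WITHOUT (∗^{j-inv}), from `2 ∈ Supp(K_V)` alone (p. 55) — the first conjunct of
`Cor22.PartI D` restricted to `UPle d`. [cite: Mochizuki2012, Cor 2.2 (i) p.41] -/
theorem partI_first_UPle (D : CBData) (hD : D.SupportContains {2}) (d : ℕ) :
    BDEquiv (D.toSet ∩ UPle d)
      (fun P => 1 / 6 * logQNotTwo P) (fun P => 1 / 6 * logQForall P) :=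
  partI_first_avoiding_UPle D hD d

/-- **Cor. 2.2 (i) on `K_V ∩ U_X(ℚ̄)^{≤d}` WITHOUT (∗^{j-inv})**: for every compactly bounded `K_V` whose
support contains `2` and every `d`, all THREE equalities of BD-classes of Cor. 2.2 (i),
`(1/6)·log(q^{∤2}) ≈ (1/6)·log(q^∀) ≈ (1/6)·ht_∞ ≈ ht_{ω_X(D)}`, hold on `K_V ∩ U_X(ℚ̄)^{≤d}` — print's
p. 55 remark for part (i) as a theorem (`Cor22.PartI D` restricted to `UPle d`, from `2 ∈ Supp(K_V)`
alone; the second and third equalities, `Cor22.partI_middle` / `Cor22.partI_third`, never used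
(∗^{j-inv})). [cite: Mochizuki2012, Cor 2.2 (i) p.41] -/
theorem partI_UPle_of_supportContains (D : CBData) (hD : D.SupportContains {2}) (d : ℕ) :
    BDEquiv (D.toSet ∩ UPle d) (fun P => 1 / 6 * logQNotTwo P) (fun P => 1 / 6 * logQForall P) ∧
    BDEquiv (D.toSet ∩ UPle d) (fun P => 1 / 6 * logQForall P) (fun P => 1 / 6 * htInfty P) ∧
    BDEquiv (D.toSet ∩ UPle d) (fun P => 1 / 6 * htInfty P) NFPoint.ht := by
  refine ⟨partI_first_UPle D hD d, ?_, ?_⟩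
  · obtain ⟨C, hC⟩ := partI_middle D
    exact ⟨C, fun P hP => hC P hP.1⟩
  · obtain ⟨C, hC⟩ := partI_third D
    exact ⟨C, fun P hP => hC P hP.1⟩

end Cor22

end Literature.IUT.LogVolume

end
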